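import Literature.RepresentationTheory.MoeglinVignerasWaldspurger1987.RankOneThetaLiftIrreducibleProofs
import Literature.RepresentationTheory.MoeglinVignerasWaldspurger1987.RankOneThetaLiftTwistRigidityOfNonPeriodic
import Literature.RepresentationTheory.TwistedCoinvariantsCompactIsotypic
import Literature.NumberTheory.Automorphic.Liu2021.Def411AsPrinted
import Literature.NumberTheory.Automorphic.Liu2021.LemD1DataOfPlaceTwist
import HarnessLib

/-!
# The `(U(1), U(1))` oscillator representation at a non-split place is multiplicity-free (rank `1 × 1`, «M1»)

Topic `RepresentationTheory/MoeglinVignerasWaldspurger1987`; namespace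
`Literature.RepresentationTheory.MoeglinVignerasWaldspurger1987` (§2) and `Literature.NumberTheory.Automorphic.UnitaryGroup`
(§1).  THEOREMS ONLY (no definition, no named fact, no `sorry`).  Cell `hodgecm-mathlib`, crux HD3
(`stmt-HodgeConjecture-24837`), residual c3 `rankOne_theta_twist_rigidity`, route R: B-p18's wrapper
`rankOne_theta_twist_rigidity_of_nonPeriodic₁₁ (hNP) (hframe) (hblock)` (`RankOneThetaLiftTwistRigidityOfNonPeriodic.lean`)
carries the wall `hNP` = «rank `1 × 1` non-periodicity» of the type set of the oscillator representation `ω_{s₁}` of the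
compact torus `U(J₁)(F_v) = E_v¹` (a `1 × 1` Gram matrix `t`, a non-split place `v`, a smooth section `s₁` over `ι_v`).
The CHARACTER ROUTE to `hNP` (cell bus 2026-08-28 05:2xZ: A-p13 / B-p04 / B-p21 / B-p18) needs, besides the torus-trace
non-vanishing (Howe's character formula) and the finite-level trace identity, the MULTIPLICITY-ONE input proved here at
the objects of the tree:

* §1 `UnitaryGroup.localCenter_one_apply` / `localCenter_one_eq_id` — for `N = 1` the local centre
  `U(J₁)(F_v) →* U(J₁)(F_v)`, `z ↦ z₀₀ · 1₁`, is the identity; `UnitaryGroup.localPi_one_mul_comm` — `U(J₁)(F_v)` is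
  commutative (families of invertible `1 × 1` matrices).
* §2 **(M1)**: `weightSpace_rankOne_eq_bot_or_eq`, `finiteDimensional_weightSpace_rankOne`,
  `finrank_coinv_rankOne_le_one` — for every unitary continuous character `ξ` of `U(J₁)(F_v)` the `ξ`-isotypic subspace
  of `ω_{s₁}` and the `ξ`-coinvariants `Coinv_ξ(ω_{s₁})` are finite-dimensional of dimension `≤ 1`.  Proof: the PROVED
  named fact `mvw_IV4_rankOne_irreducibleOrZero_holds` ([MVW87, Chap. 3 §IV.4 Thm. principal 1) a)];
  `RankOneThetaLiftIrreducibleProofs.lean`) at `N := 1`, `J := J₁` says the representation of `U(J₁)(F_v)` on `Coinv_ξ`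
  is irreducible-or-zero; by the compact-group dictionary (`TwistedCoinv.isIrreducibleOrZero_rep_iff`,
  `TwistedCoinv.exists_linearEquiv_weightSpace_coinv`, [BernsteinZelevinsky1976, §2.3]) every `U(J₁)(F_v)`-stable
  subspace of the `ξ`-isotypic subspace is trivial; `U(J₁)(F_v)` being its own centre (§1) acts there by the scalars
  `ξ`, so EVERY subspace is stable and the isotypic subspace is a line or zero.  (Also recorded: `c ≠ 1`, the entry of
  `J₁` is non-zero, every `w ∣ v` is `c`-fixed, `U(J₁)(F_v)` is compact, continuous characters have open kernel — the
  non-split bookkeeping, by name from `UnitaryGroupNonsplitTorus` / `Def411WeilCarriersSurvivalNonsplit`.)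

* §3 the same in the OPEN-KERNEL currency of the finite-level trace identity (B-p21's (M2) `hmult` binder, cell bus
  2026-08-28 05:32Z): `norm_apply_eq_one_of_isOpen_ker_rankOne`, `continuous_apply_of_isOpen_ker_rankOne` (an
  open-kernel character of the compact `U(J₁)(F_v)` is unitary and continuous) and
  **`finrank_weightSpace_rankOne_le_one_of_isOpen_ker`**:
  `∀ χ, IsOpen χ.ker → finrank ℂ (weightSpace ω_{s₁} id χ) ≤ 1`, and the CARDINAL-RANK form
  **`rank_weightSpace_rankOne_le_one_of_isOpen_ker`**: `∀ χ, IsOpen χ.ker → Module.rank ℂ (weightSpace ω_{s₁} id χ) ≤ 1`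
  (B-p21's `hmult` text of record, erratum 05:34Z: the rank bound carries finite-dimensionality).

* §4 **(L0-existence)** `exists_mul_self_ne_one`: `U(J₁)(F_v)` contains an element `z` with `z * z ≠ 1` (every
  place; witness the norm-one scalar `ζ = (1 + δ)/(1 − δ) ∈ E`, `ζ² ≠ 1` in `E`, read on the `w`-entries) — the torus-side
  input of the assembly's choice of a test element `z₀ ∉ ker η₁` with `z₀² ≠ 1` (arbiter ruling #2, 2026-08-28 05:51Z).

HC_CM is NOT proved here: HC_CM is proved only modulo the 7 printed citations until rung 0 of the ladder closes.

## References
* [MoeglinVignerasWaldspurger1987] C. Mœglin, M.-F. Vignéras, J.-L. Waldspurger, LNM 1291 (1987), Chap. 3 §IV.4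
  Théorème principal 1) a); Chap. 2 II.2.
* [BernsteinZelevinsky1976] I. N. Bernstein, A. V. Zelevinsky, Russian Math. Surveys 31 (1976), §2.1–2.3.
* [Liu2021] Y. Liu, Camb. J. Math. 9 (2021), App. D Lem. D.1 (3).
-/

set_option autoImplicit false

noncomputable section

open NumberField IsDedekindDomain Matrix
open scoped Matrix MatrixGroups
open Literature.RepresentationTheory Literature.RepresentationTheory.HeisenbergGroup
open Literature.NumberTheory.GelbartRogawski1991.UnitaryDualPair.LocalSplitting
open Literature.NumberTheory.Automorphic Literature.NumberTheory.Automorphic.UnitaryGroup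
open Literature.NumberTheory.Automorphic.Liu2021

/-! ## §1 `N = 1`: the local centre is the identity and `U(J₁)(F_v)` is commutative -/

namespace Literature.NumberTheory.Automorphic.UnitaryGroup

section One

variable {F : Type} [Field F] [NumberField F] (E : Type) [Field E] [NumberField E] [Algebra F E]
  (c : E ≃ₐ[F] E) (J₁ : Matrix (Fin 1) (Fin 1) E)

omit [NumberField F] in
/-- A `1 × 1` matrix is the scalar matrix of its entry. [folklore] -/
private theorem matrix_fin_one_eq_smul_one {R : Type*} [Semiring R] (M : Matrix (Fin 1) (Fin 1) R) :
    M = M 0 0 • (1 : Matrix (Fin 1) (Fin 1) R) := by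
  ext i j
  obtain rfl : i = 0 := Subsingleton.elim _ _
  obtain rfl : j = 0 := Subsingleton.elim _ _
  rw [Matrix.smul_apply, Matrix.one_apply_eq, smul_eq_mul, mul_one]

/-- **For `N = 1` the local centre `U(J₁)(F_v) →* U(J₁)(F_v)`, `z ↦ (z₀₀ · 1₁)`, is the identity.**
[cite: Mok2014, §1 Notation p. 5] -/
theorem localCenter_one_apply (hJ₁ : J₁ 0 0 ≠ 0) (v : HeightOneSpectrum (𝓞 F)) (g : localPi E c 1 J₁ v) :
    localCenter E c 1 J₁ J₁ hJ₁ v g = g := by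
  refine Subtype.ext (funext fun w => Units.ext ?_)
  rw [coe_localCenter, coe_localScalarGL_apply]
  exact (matrix_fin_one_eq_smul_one _).symm

/-- For `N = 1` the local centre is the identity homomorphism. [cite: Mok2014, §1 Notation p. 5] -/
theorem localCenter_one_eq_id (hJ₁ : J₁ 0 0 ≠ 0) (v : HeightOneSpectrum (𝓞 F)) :
    localCenter E c 1 J₁ J₁ hJ₁ v = MonoidHom.id _ :=
  MonoidHom.ext fun g => localCenter_one_apply E c J₁ hJ₁ v g

/-- **`U(J₁)(F_v)` is commutative** (its elements are families of invertible `1 × 1` matrices) — the rank-one unitary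
group `E_v¹` is a torus, the centre of every `U(V)(F_v)`. [cite: Liu2021, App. D §D.1 Step 3] -/
theorem localPi_one_mul_comm (v : HeightOneSpectrum (𝓞 F)) (g h : localPi E c 1 J₁ v) : g * h = h * g := by
  refine Subtype.ext (funext fun w => Units.ext ?_)
  change ((g : LocalGLPi E 1 v) w : Matrix (Fin 1) (Fin 1) (w.1.adicCompletion E)) * ((h : LocalGLPi E 1 v) w) =
    ((h : LocalGLPi E 1 v) w : Matrix (Fin 1) (Fin 1) (w.1.adicCompletion E)) * ((g : LocalGLPi E 1 v) w)
  set A : Matrix (Fin 1) (Fin 1) (w.1.adicCompletion E) :=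
    (((g : LocalGLPi E 1 v) w : GL (Fin 1) (w.1.adicCompletion E)) : Matrix (Fin 1) (Fin 1) (w.1.adicCompletion E))
  set B : Matrix (Fin 1) (Fin 1) (w.1.adicCompletion E) :=
    (((h : LocalGLPi E 1 v) w : GL (Fin 1) (w.1.adicCompletion E)) : Matrix (Fin 1) (Fin 1) (w.1.adicCompletion E))
  rw [matrix_fin_one_eq_smul_one A, matrix_fin_one_eq_smul_one B, smul_mul_smul_comm, smul_mul_smul_comm (B 0 0),
    mul_comm (A 0 0) (B 0 0)]

end One

end Literature.NumberTheory.Automorphic.UnitaryGroup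

/-! ## §2 (M1) multiplicity one of the `(U(1), U(1))` oscillator types -/

namespace Literature.RepresentationTheory.MoeglinVignerasWaldspurger1987

section MultOne

variable (F : Type) [Field F] [NumberField F] (E : Type) [Field E] [NumberField E] [Algebra F E]
  [Algebra.IsQuadraticExtension F E] (c : E ≃ₐ[F] E) {δ : E} (hcδ : c δ = -δ) (hδ : δ ≠ 0) {d : F}
  (hd : δ * δ = algebraMap F E d) {t : Matrix (Fin 1) (Fin 1) F} (ht : t.IsSymm) (htd : IsUnit t.det)
  {J₁ : Matrix (Fin 1) (Fin 1) E} (hJ₁ : J₁ = t.map (algebraMap F E)) (v : HeightOneSpectrum (𝓞 F))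
  (hE : IsField (UnitaryGroup.LocalRing E v))
  (s₁ : localPi E c 1 J₁ v →* LocalMp F 1 t v)
  (hs₁ : ∀ g, MpPsi.proj _ (s₁ g) = iota F E c 1 hcδ hδ hd t ht hJ₁ v g)
  (hsm₁ : Representation.IsSmooth ((MpPsi.toRep (localSchrodinger F 1 t v)).comp s₁))

omit [NumberField F] [NumberField E] [Algebra.IsQuadraticExtension F E] in
include htd hJ₁ in
/-- the entry of the hermitian line `J₁ = t ⊗ 1` is non-zero (`det t` is a unit). [folklore] -/
private theorem entry_ne_zero_of_isUnit_det : J₁ 0 0 ≠ 0 := by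
  rw [hJ₁, Matrix.map_apply, map_ne_zero_iff _ (algebraMap F E).injective, ← Matrix.det_fin_one t]
  exact htd.ne_zero

include hcδ hδ in
omit [NumberField F] [Algebra.IsQuadraticExtension F E] in
/-- `c ≠ 1` (it negates the non-zero `δ`). [folklore] -/
private theorem galConj_ne_one : c ≠ 1 := by
  rintro rfl
  exact hδ (self_eq_neg.1 (by simpa only [AlgEquiv.one_apply] using hcδ))

include hE in
/-- at a non-split place every place `w ∣ v` of `E` is fixed by `c`. [cite: CasselsFrohlichANT1967, Ch. II §10] -/
theorem smul_placesOver_eq_of_isField (w : PlacesOver E v) : c • w.1 = w.1 := by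
  by_contra hw
  exact LemD1IndexedNonVacuityAtPlace.not_isField_localRing_of_split E v c w hw hE

include hcδ hδ htd hJ₁ hE in
/-- **`U(J₁)(F_v) = E_v¹` is compact** at a non-split place. [cite: PlatonovRapinchuk1994, §6.2] -/
theorem compactSpace_localPi_rankOne : CompactSpace (localPi E c 1 J₁ v) := by
  obtain ⟨w⟩ := (inferInstance : Nonempty (PlacesOver E v))
  exact compactSpace_localPi_one_of_smul_eq c J₁ (galConj_ne_one F E c hcδ hδ)
    (entry_ne_zero_of_isUnit_det F E htd hJ₁) w (smul_placesOver_eq_of_isField F E c v hE w)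

include hcδ hδ htd hJ₁ hE in
/-- a continuous character of `U(J₁)(F_v)` has open kernel (non-split `v`). [cite: BernsteinZelevinsky1976, §2.1] -/
theorem isOpen_ker_rankOne (ξ : localPi E c 1 J₁ v →* ℂˣ) (hξc : Continuous fun u => ((ξ u : ℂˣ) : ℂ)) :
    IsOpen ((ξ.ker : Subgroup (localPi E c 1 J₁ v)) : Set (localPi E c 1 J₁ v)) := by
  obtain ⟨w⟩ := (inferInstance : Nonempty (PlacesOver E v))
  exact isOpen_ker_of_smul_eq c J₁ (galConj_ne_one F E c hcδ hδ) (entry_ne_zero_of_isUnit_det F E htd hJ₁) w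
    (smul_placesOver_eq_of_isField F E c v hE w) ξ hξc

include hd ht hs₁ hE htd hsm₁ in
/-- **(M1) — every subspace of a `ξ`-isotypic subspace of `ω_{s₁}` is `⊥` or everything** (rank `1 × 1`, non-split
`v`, `ξ` unitary continuous): [MVW87, Chap. 3 §IV.4 Thm. principal 1) a)] at `N = 1` (tree
`mvw_IV4_rankOne_irreducibleOrZero_holds`) read on the isotypic subspace through the compact-group dictionary; the group
being its own centre, stability under `U(J₁)(F_v)` is automatic.
[cite: MoeglinVignerasWaldspurger1987, Chap. 3 §IV.4 Théorème principal 1) a)] -/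
theorem weightSpace_rankOne_eq_bot_or_eq (ξ : localPi E c 1 J₁ v →* ℂˣ) (hξu : ∀ u, ‖((ξ u : ℂˣ) : ℂ)‖ = 1)
    (hξc : Continuous fun u => ((ξ u : ℂˣ) : ℂ))
    (W : Submodule ℂ (SchwartzBruhat (Fin 1 → v.adicCompletion F)))
    (hW : W ≤ weightSpace ((MpPsi.toRep (localSchrodinger F 1 t v)).comp s₁) id (fun h => ((ξ h : ℂˣ) : ℂ))) :
    W = ⊥ ∨ W = weightSpace ((MpPsi.toRep (localSchrodinger F 1 t v)).comp s₁) id (fun h => ((ξ h : ℂˣ) : ℂ)) := by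
  have hJ₁0 : J₁ 0 0 ≠ 0 := entry_ne_zero_of_isUnit_det F E htd hJ₁
  haveI : CompactSpace (localPi E c 1 J₁ v) := compactSpace_localPi_rankOne F E c hcδ hδ htd hJ₁ v hE
  have hirr := mvw_IV4_rankOne_irreducibleOrZero_holds F E c 1 δ hcδ hδ d hd t ht htd J₁ hJ₁ v hE s₁ hs₁ hsm₁ J₁ hJ₁0
    ξ hξu hξc
  set ω : Representation ℂ (localPi E c 1 J₁ v) (SchwartzBruhat (Fin 1 → v.adicCompletion F)) :=
    (MpPsi.toRep (localSchrodinger F 1 t v)).comp s₁ with hω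
  let M : Representation ℂ (localPi E c 1 J₁ v) (SchwartzBruhat (Fin 1 → v.adicCompletion F)) :=
    ω.comp (localCenter E c 1 J₁ J₁ hJ₁0 v)
  have hMω : M = ω := by
    change ω.comp (localCenter E c 1 J₁ J₁ hJ₁0 v) = ω
    rw [localCenter_one_eq_id E c J₁ hJ₁0 v, MonoidHom.comp_id]
  have hMs : M.IsSmooth := by rw [hMω]; exact hsm₁
  have hξo : IsOpen (ξ.ker : Set (localPi E c 1 J₁ v)) := isOpen_ker_rankOne F E c hcδ hδ htd hJ₁ v hE ξ hξc
  have hcomm : ∀ (g : localPi E c 1 J₁ v) (z : localPi E c 1 J₁ v), Commute (ω g) (M z) := fun g z =>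
    (show Commute g (localCenter E c 1 J₁ J₁ hJ₁0 v z) from localCenter_comm E c 1 J₁ J₁ hJ₁0 v z g).map ω
  have hlat := (TwistedCoinv.isIrreducibleOrZero_rep_iff M ξ ω hcomm hMs hξo).1 hirr
  rw [hMω] at hlat
  refine hlat W hW fun g => ?_
  rintro _ ⟨w, hw, rfl⟩
  have hw' := hW hw
  rw [show ω g w = ((ξ g : ℂˣ) : ℂ) • w from apply_of_mem_weightSpace hw' g]
  exact W.smul_mem _ hw

include hd ht hs₁ hE htd hsm₁ in
/-- **(M1) multiplicity one, isotypic form**: the `ξ`-isotypic subspace of `ω_{s₁}` is finite-dimensional of dimension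
`≤ 1` (rank `1 × 1`, non-split `v`, `ξ` unitary continuous). [cite: MoeglinVignerasWaldspurger1987, Chap. 3 §IV.4 Théorème principal 1) a)] -/
theorem finiteDimensional_weightSpace_rankOne (ξ : localPi E c 1 J₁ v →* ℂˣ) (hξu : ∀ u, ‖((ξ u : ℂˣ) : ℂ)‖ = 1)
    (hξc : Continuous fun u => ((ξ u : ℂˣ) : ℂ)) :
    FiniteDimensional ℂ (weightSpace ((MpPsi.toRep (localSchrodinger F 1 t v)).comp s₁) id (fun h => ((ξ h : ℂˣ) : ℂ))) ∧
      Module.finrank ℂ (weightSpace ((MpPsi.toRep (localSchrodinger F 1 t v)).comp s₁) id (fun h => ((ξ h : ℂˣ) : ℂ))) ≤ 1 := by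
  set V := weightSpace ((MpPsi.toRep (localSchrodinger F 1 t v)).comp s₁) id (fun h => ((ξ h : ℂˣ) : ℂ)) with hV
  have hlat := weightSpace_rankOne_eq_bot_or_eq F E c hcδ hδ hd ht htd hJ₁ v hE s₁ hs₁ hsm₁ ξ hξu hξc
  by_cases h0 : V = ⊥
  · rw [h0]
    exact ⟨inferInstance, by rw [finrank_bot]; exact zero_le_one⟩
  · obtain ⟨x, hxV, hx0⟩ := (Submodule.ne_bot_iff V).1 h0
    have hspan : (ℂ ∙ x) = V := by
      rcases hlat (ℂ ∙ x) ((Submodule.span_singleton_le_iff_mem x V).2 hxV) with h | h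
      · exact absurd (by rw [← Submodule.mem_bot ℂ, ← h]; exact Submodule.mem_span_singleton_self x) hx0
      · exact h
    rw [← hspan]
    exact ⟨inferInstance, (finrank_span_singleton hx0).le⟩

set_option maxHeartbeats 400000 in
include hd ht hs₁ hE htd hsm₁ in
/-- **(M1) multiplicity one, coinvariant form**: `dim_ℂ Coinv_ξ(ω_{s₁}) ≤ 1` (and the coinvariants are
finite-dimensional) for every unitary continuous character `ξ` of the compact torus `U(J₁)(F_v) = E_v¹` at a non-split
place — the `(U(1), U(1))` theta correspondence is multiplicity-free.  [MVW87, Chap. 3 §IV.4 Thm. principal 1) a)] at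
`N = 1` (tree `mvw_IV4_rankOne_irreducibleOrZero_holds`) + the compact-group dictionary `Coinv_ξ ≅` isotypic subspace
(`TwistedCoinv.exists_linearEquiv_weightSpace_coinv`). [cite: MoeglinVignerasWaldspurger1987, Chap. 3 §IV.4 Théorème principal 1) a)] -/
theorem finrank_coinv_rankOne_le_one (ξ : localPi E c 1 J₁ v →* ℂˣ) (hξu : ∀ u, ‖((ξ u : ℂˣ) : ℂ)‖ = 1)
    (hξc : Continuous fun u => ((ξ u : ℂˣ) : ℂ)) :
    FiniteDimensional ℂ (TwistedCoinv.Coinv ((MpPsi.toRep (localSchrodinger F 1 t v)).comp s₁) ξ) ∧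
      Module.finrank ℂ (TwistedCoinv.Coinv ((MpPsi.toRep (localSchrodinger F 1 t v)).comp s₁) ξ) ≤ 1 := by
  haveI : CompactSpace (localPi E c 1 J₁ v) := compactSpace_localPi_rankOne F E c hcδ hδ htd hJ₁ v hE
  have hξo : IsOpen (ξ.ker : Set (localPi E c 1 J₁ v)) := isOpen_ker_rankOne F E c hcδ hδ htd hJ₁ v hE ξ hξc
  obtain ⟨e, -⟩ := TwistedCoinv.exists_linearEquiv_weightSpace_coinv ((MpPsi.toRep (localSchrodinger F 1 t v)).comp s₁)
    ξ hsm₁ hξo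
  obtain ⟨hfin, hle⟩ := finiteDimensional_weightSpace_rankOne F E c hcδ hδ hd ht htd hJ₁ v hE s₁ hs₁ hsm₁ ξ hξu hξc
  haveI := hfin
  exact ⟨Module.Finite.equiv e, by rwa [← e.finrank_eq]⟩

end MultOne

/-! ## §3 (M1) in the open-kernel currency -/

section OpenKer

variable (F : Type) [Field F] [NumberField F] (E : Type) [Field E] [NumberField E] [Algebra F E]
  [Algebra.IsQuadraticExtension F E] (c : E ≃ₐ[F] E) {δ : E} (hcδ : c δ = -δ) (hδ : δ ≠ 0) {d : F}
  (hd : δ * δ = algebraMap F E d) {t : Matrix (Fin 1) (Fin 1) F} (ht : t.IsSymm) (htd : IsUnit t.det)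
  {J₁ : Matrix (Fin 1) (Fin 1) E} (hJ₁ : J₁ = t.map (algebraMap F E)) (v : HeightOneSpectrum (𝓞 F))
  (hE : IsField (UnitaryGroup.LocalRing E v))
  (s₁ : localPi E c 1 J₁ v →* LocalMp F 1 t v)
  (hs₁ : ∀ g, MpPsi.proj _ (s₁ g) = iota F E c 1 hcδ hδ hd t ht hJ₁ v g)
  (hsm₁ : Representation.IsSmooth ((MpPsi.toRep (localSchrodinger F 1 t v)).comp s₁))

omit [Algebra.IsQuadraticExtension F E] in
include htd hJ₁ in
/-- **an open-kernel character of `U(J₁)(F_v)` is continuous** (locally constant). [cite: BernsteinZelevinsky1976, §2.1] -/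
theorem continuous_apply_of_isOpen_ker_rankOne (χ : localPi E c 1 J₁ v →* ℂˣ)
    (hχ : IsOpen (χ.ker : Set (localPi E c 1 J₁ v))) : Continuous fun u => ((χ u : ℂˣ) : ℂ) := by
  have hJ₁0 : J₁ 0 0 ≠ 0 := entry_ne_zero_of_isUnit_det F E htd hJ₁
  refine (LemD1OfPlace.continuous_eta_localCenter E v c 1 J₁ J₁ hJ₁0 χ hχ).congr fun u => ?_
  rw [localCenter_one_apply E c J₁ hJ₁0 v u]

include hcδ hδ htd hJ₁ hE in
/-- **an open-kernel character of `U(J₁)(F_v)` is unitary** at a non-split place (`U(J₁)(F_v) = E_v¹` is compact).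
[cite: PlatonovRapinchuk1994, §6.2] -/
theorem norm_apply_eq_one_of_isOpen_ker_rankOne (χ : localPi E c 1 J₁ v →* ℂˣ)
    (hχ : IsOpen (χ.ker : Set (localPi E c 1 J₁ v))) (u : localPi E c 1 J₁ v) : ‖((χ u : ℂˣ) : ℂ)‖ = 1 := by
  have hJ₁0 : J₁ 0 0 ≠ 0 := entry_ne_zero_of_isUnit_det F E htd hJ₁
  obtain ⟨w⟩ := (inferInstance : Nonempty (PlacesOver E v))
  have h := LemD1OfPlace.norm_eta_localCenter_eq_one E v c 1 J₁ J₁ hJ₁0 χ (galConj_ne_one F E c hcδ hδ) w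
    (smul_placesOver_eq_of_isField F E c v hE w) hχ u
  rwa [localCenter_one_apply E c J₁ hJ₁0 v u] at h

include hd ht hs₁ hE htd hsm₁ in
/-- **(M1) in the open-kernel currency** — the `hmult` input of the finite-level trace identity (cell bus, B-p21 (M2)):
for EVERY open-kernel character `χ` of `U(J₁)(F_v)` the `χ`-isotypic subspace of `ω_{s₁}` has dimension `≤ 1`
(rank `1 × 1`, non-split `v`; open kernel ⇒ unitary and continuous on the compact torus, then
`finiteDimensional_weightSpace_rankOne`). [cite: MoeglinVignerasWaldspurger1987, Chap. 3 §IV.4 Théorème principal 1) a)] -/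
theorem finrank_weightSpace_rankOne_le_one_of_isOpen_ker :
    ∀ χ : localPi E c 1 J₁ v →* ℂˣ, IsOpen (χ.ker : Set (localPi E c 1 J₁ v)) →
      Module.finrank ℂ ↥(weightSpace ((MpPsi.toRep (localSchrodinger F 1 t v)).comp s₁) id
        fun k => ((χ k : ℂˣ) : ℂ)) ≤ 1 :=
  fun χ hχ => (finiteDimensional_weightSpace_rankOne F E c hcδ hδ hd ht htd hJ₁ v hE s₁ hs₁ hsm₁ χ
    (norm_apply_eq_one_of_isOpen_ker_rankOne F E c hcδ hδ htd hJ₁ v hE χ hχ)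
    (continuous_apply_of_isOpen_ker_rankOne F E c htd hJ₁ v χ hχ)).2

include hd ht hs₁ hE htd hsm₁ in
/-- (M1), open-kernel currency, coinvariant form: `dim_ℂ Coinv_χ(ω_{s₁}) ≤ 1` for every open-kernel character `χ` of
`U(J₁)(F_v)` (non-split `v`). [cite: MoeglinVignerasWaldspurger1987, Chap. 3 §IV.4 Théorème principal 1) a)] -/
theorem finrank_coinv_rankOne_le_one_of_isOpen_ker (χ : localPi E c 1 J₁ v →* ℂˣ)
    (hχ : IsOpen (χ.ker : Set (localPi E c 1 J₁ v))) :
    FiniteDimensional ℂ (TwistedCoinv.Coinv ((MpPsi.toRep (localSchrodinger F 1 t v)).comp s₁) χ) ∧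
      Module.finrank ℂ (TwistedCoinv.Coinv ((MpPsi.toRep (localSchrodinger F 1 t v)).comp s₁) χ) ≤ 1 :=
  finrank_coinv_rankOne_le_one F E c hcδ hδ hd ht htd hJ₁ v hE s₁ hs₁ hsm₁ χ
    (norm_apply_eq_one_of_isOpen_ker_rankOne F E c hcδ hδ htd hJ₁ v hE χ hχ)
    (continuous_apply_of_isOpen_ker_rankOne F E c htd hJ₁ v χ hχ)

include hd ht hs₁ hE htd hsm₁ in
/-- **(M1), open-kernel currency, CARDINAL-RANK form** — the `hmult` binder of the finite-level trace identity VERBATIM at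
`K := U(J₁)(F_v)`, `ρ := ω_{s₁}`: for every open-kernel character `χ` of `U(J₁)(F_v)`,
`Module.rank ℂ (weightSpace ω_{s₁} id χ) ≤ 1` (so the weight space is finite-dimensional of dimension `≤ 1`; rank
`1 × 1`, non-split `v`). [cite: MoeglinVignerasWaldspurger1987, Chap. 3 §IV.4 Théorème principal 1) a)] -/
theorem rank_weightSpace_rankOne_le_one_of_isOpen_ker :
    ∀ χ : localPi E c 1 J₁ v →* ℂˣ, IsOpen (χ.ker : Set (localPi E c 1 J₁ v)) →
      Module.rank ℂ ↥(weightSpace ((MpPsi.toRep (localSchrodinger F 1 t v)).comp s₁) id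
        fun k => ((χ k : ℂˣ) : ℂ)) ≤ 1 := by
  intro χ hχ
  obtain ⟨hfin, hle⟩ := finiteDimensional_weightSpace_rankOne F E c hcδ hδ hd ht htd hJ₁ v hE s₁ hs₁ hsm₁ χ
    (norm_apply_eq_one_of_isOpen_ker_rankOne F E c hcδ hδ htd hJ₁ v hE χ hχ)
    (continuous_apply_of_isOpen_ker_rankOne F E c htd hJ₁ v χ hχ)
  haveI := hfin
  rw [← Module.finrank_eq_rank]
  exact_mod_cast hle

include hd ht hs₁ hE htd hsm₁ in
/-- (M1), CARDINAL-RANK form for UNITARY CONTINUOUS characters (hNP's own currency for `ξ`):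
`Module.rank ℂ (weightSpace ω_{s₁} id ξ) ≤ 1`. [cite: MoeglinVignerasWaldspurger1987, Chap. 3 §IV.4 Théorème principal 1) a)] -/
theorem rank_weightSpace_rankOne_le_one (ξ : localPi E c 1 J₁ v →* ℂˣ) (hξu : ∀ u, ‖((ξ u : ℂˣ) : ℂ)‖ = 1)
    (hξc : Continuous fun u => ((ξ u : ℂˣ) : ℂ)) :
    Module.rank ℂ ↥(weightSpace ((MpPsi.toRep (localSchrodinger F 1 t v)).comp s₁) id
      fun k => ((ξ k : ℂˣ) : ℂ)) ≤ 1 := by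
  obtain ⟨hfin, hle⟩ := finiteDimensional_weightSpace_rankOne F E c hcδ hδ hd ht htd hJ₁ v hE s₁ hs₁ hsm₁ ξ hξu hξc
  haveI := hfin
  rw [← Module.finrank_eq_rank]
  exact_mod_cast hle

end OpenKer

/-! ## §4 (L0) a torus element of square `≠ 1` -/

section SquareNeOne

variable (F : Type) [Field F] [NumberField F] (E : Type) [Field E] [NumberField E] [Algebra F E]
  (c : E ≃ₐ[F] E) {δ : E} (hcδ : c δ = -δ) (hδ : δ ≠ 0)
  (J₁ : Matrix (Fin 1) (Fin 1) E) (v : HeightOneSpectrum (𝓞 F))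

/-- the `w`-entry of a product in `U(J₁)(F_v)` is the product of the entries (`1 × 1` matrices). [folklore] -/
private theorem entry_mul (g h : localPi E c 1 J₁ v) (w : PlacesOver E v) :
    ((((g * h : localPi E c 1 J₁ v) : LocalGLPi E 1 v) w : GL (Fin 1) (w.1.adicCompletion E)) :
        Matrix (Fin 1) (Fin 1) (w.1.adicCompletion E)) 0 0 =
      ((((g : localPi E c 1 J₁ v) : LocalGLPi E 1 v) w : GL (Fin 1) (w.1.adicCompletion E)) :
          Matrix (Fin 1) (Fin 1) (w.1.adicCompletion E)) 0 0 *
        ((((h : localPi E c 1 J₁ v) : LocalGLPi E 1 v) w : GL (Fin 1) (w.1.adicCompletion E)) :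
          Matrix (Fin 1) (Fin 1) (w.1.adicCompletion E)) 0 0 := by
  change ((((g : LocalGLPi E 1 v) w * (h : LocalGLPi E 1 v) w : GL (Fin 1) (w.1.adicCompletion E)) :
    Matrix (Fin 1) (Fin 1) (w.1.adicCompletion E)) 0 0) = _
  rw [Units.val_mul, Matrix.mul_apply, Fin.sum_univ_one]

/-- the `w`-entry of `1 ∈ U(J₁)(F_v)` is `1`. [folklore] -/
private theorem entry_one (w : PlacesOver E v) :
    ((((1 : localPi E c 1 J₁ v) : LocalGLPi E 1 v) w : GL (Fin 1) (w.1.adicCompletion E)) :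
        Matrix (Fin 1) (Fin 1) (w.1.adicCompletion E)) 0 0 = 1 := by
  change ((((1 : LocalGLPi E 1 v) w : GL (Fin 1) (w.1.adicCompletion E)) :
    Matrix (Fin 1) (Fin 1) (w.1.adicCompletion E)) 0 0) = 1
  rw [Pi.one_apply, Units.val_one, Matrix.one_apply_eq]

include hcδ hδ in
/-- **(L0) `U(J₁)(F_v)` has an element of square `≠ 1`** (every place `v`, every line `J₁`): the norm-one scalar
`ζ = (1 + δ)/(1 − δ) ∈ E` (`c δ = −δ`, so `ζ · c ζ = 1`) satisfies `ζ² ≠ 1` in `E` (`δ ≠ 0`, `2 ≠ 0`), and its image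
`localUnitScalar (ζ ⊗ 1) ∈ U(J₁)(F_v)` has `w`-entries `ζ ∈ E_w`, so its square is not `1`.  Used by the assembly of
the c3 character route to pick a test element `z₀` with `η₁ z₀ ≠ 1` and `z₀² ≠ 1` (Weil's big cell).
[cite: PlatonovRapinchuk1994, §6.2] -/
theorem exists_mul_self_ne_one : ∃ z : localPi E c 1 J₁ v, z * z ≠ 1 := by
  have h2E : (2 : E) ≠ 0 := two_ne_zero
  have h1m : (1 : E) - δ ≠ 0 := by
    intro h
    have hδ1 : δ = 1 := (sub_eq_zero.1 h).symm
    rw [hδ1, map_one] at hcδ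
    exact h2E (by linear_combination hcδ)
  have h1p : (1 : E) + δ ≠ 0 := by
    intro h
    have hδ1 : δ = -1 := eq_neg_of_add_eq_zero_right h
    rw [hδ1, map_neg, map_one] at hcδ
    exact h2E (by linear_combination -hcδ)
  set ζ : E := (1 + δ) / (1 - δ) with hζ
  have hζ0 : ζ ≠ 0 := div_ne_zero h1p h1m
  have hcζ : c ζ = (1 - δ) / (1 + δ) := by
    rw [hζ, map_div₀, map_add, map_sub, map_one, hcδ, sub_neg_eq_add, ← sub_eq_add_neg]
  have hζζ : ζ * c ζ = 1 := by
    rw [hcζ, hζ]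
    field_simp
  have hζ1 : ζ * ζ ≠ 1 := by
    intro h
    rcases mul_self_eq_one_iff.1 h with h1 | h1
    · have h1' : 1 + δ = 1 - δ := (div_eq_one_iff_eq h1m).1 (by rw [← hζ]; exact h1)
      apply hδ
      have : (2 : E) * δ = 0 := by linear_combination h1'
      exact (mul_eq_zero.1 this).resolve_left h2E
    · have h1' : 1 + δ = -1 * (1 - δ) := (div_eq_iff h1m).1 (by rw [← hζ]; exact h1)
      exact h2E (by linear_combination h1')
  let z : (LocalRing E v)ˣ := Units.map (algebraMap E (LocalRing E v)).toMonoidHom (Units.mk0 ζ hζ0)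
  have hzval : (z : LocalRing E v) = algebraMap E (LocalRing E v) ζ := rfl
  have hzn : (z : LocalRing E v) * conjLocal E c v z = 1 := by
    rw [hzval, conjLocal_algebraMap, ← map_mul, hζζ, map_one]
  refine ⟨localUnitScalar E c J₁ v z hzn, fun h => hζ1 ?_⟩
  obtain ⟨w⟩ := (inferInstance : Nonempty (PlacesOver E v))
  have hw := congrArg (fun g : localPi E c 1 J₁ v =>
    (((g : LocalGLPi E 1 v) w : GL (Fin 1) (w.1.adicCompletion E)) : Matrix (Fin 1) (Fin 1) (w.1.adicCompletion E)) 0 0) h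
  simp only [entry_mul, entry_one, coe_localUnitScalar_apply, hzval, Pi.algebraMap_apply] at hw
  refine (algebraMap E (w.1.adicCompletion E)).injective ?_
  rw [map_mul, map_one]
  exact hw

end SquareNeOne

end Literature.RepresentationTheory.MoeglinVignerasWaldspurger1987

end
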